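import Literature.NumberTheory.LFunctions.WeilTwoPrimeOddMarginGBase
import Literature.NumberTheory.LFunctions.WeilBlockRowsPZ
import HarnessLib

/-!
# Two-prime odd-margin certificate G: the Bessel block claim `Hp = C H Cᵀ`, rows 5–9

`WeilCert.checkHpRow` for rows 5–9 of certificate G (the exact Legendre cancellation `C H Cᵀ = diag(2a₀/(4i+3))`), by `decide +kernel`. Pure proof file.
-/

noncomputable section

namespace Literature.NumberTheory.LFunctions

set_option maxHeartbeats 0 in
/-- Row 5 of `C H Cᵀ` is row 5 of `Hp` (certificate G). [folklore] -/
theorem checkHpRow1_5_weilCert23G : weilCert23GBase.checkHpRow weilCert23GHp 1 5 = true := by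
  decide +kernel

set_option maxHeartbeats 0 in
/-- Row 6 of `C H Cᵀ` is row 6 of `Hp` (certificate G). [folklore] -/
theorem checkHpRow1_6_weilCert23G : weilCert23GBase.checkHpRow weilCert23GHp 1 6 = true := by
  decide +kernel

set_option maxHeartbeats 0 in
/-- Row 7 of `C H Cᵀ` is row 7 of `Hp` (certificate G). [folklore] -/
theorem checkHpRow1_7_weilCert23G : weilCert23GBase.checkHpRow weilCert23GHp 1 7 = true := by
  decide +kernel

set_option maxHeartbeats 0 in
/-- Row 8 of `C H Cᵀ` is row 8 of `Hp` (certificate G). [folklore] -/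
theorem checkHpRow1_8_weilCert23G : weilCert23GBase.checkHpRow weilCert23GHp 1 8 = true := by
  decide +kernel

set_option maxHeartbeats 0 in
/-- Row 9 of `C H Cᵀ` is row 9 of `Hp` (certificate G). [folklore] -/
theorem checkHpRow1_9_weilCert23G : weilCert23GBase.checkHpRow weilCert23GHp 1 9 = true := by
  decide +kernel

end Literature.NumberTheory.LFunctions
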